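import Mathlib.Combinatorics.SimpleGraph.Basic
import Mathlib.Algebra.BigOperators.Ring.Finset
import Mathlib.Algebra.Group.Nat.Even
import Mathlib.Data.Sym.Sym2
import Mathlib.Logic.Relation
import Literature.Probability.Percolation.TileDomain
import HarnessLib

/-!
# Parity engine for the beach structure of the gluing construction: even edge sets and winding numbers of closed lattice walks

Topic `Probability/Percolation`.  Support file (definitions and proofs, no named fact) for step (C)
of the proof of Schramm–Smirnov's Prop. 4.1 (Ann. Probab. 39 (2011), §4, "Bays and beaches",
"It is easy to see that the beach is connected"): in bond percolation on `ℤ²` the boundary between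
the wet (dual-explored) faces and the dry faces is an EVEN edge set, and the two combinatorial
tools by which the beach-connectivity and the counting of beaches are proved in the sequel are

* **the parity lemma** (`reflTransGen_erase_of_even`, `reflTransGen_erase_erase_of_even`): in a
  finite edge set all of whose vertex degrees are even, the two ends of an edge remain joined after
  deleting it (an even graph has no bridge: the component of one end would have odd degree sum,
  `even_sum_card_filter`), and likewise the two outer ends of a path of two edges after deleting
  both;
* **winding numbers of closed lattice walks in `ℤ²` language** (`ClosedWalk.ofSites`, the closed
  walk of a periodic sequence of lattice neighbours; `W_faceAt_eq_of_notMem`, the four faces at a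
  lattice point off the walk have the same winding number; `W_left_sub_W_right`, across the edge of
  a dart the winding number jumps by the net number of traversals; `W_eq_of_cnt_eq_zero`), on top
  of the tree's `ClosedWalk.W` (`LatticeLoopWinding.lean`).

## References

* O. Schramm, S. Smirnov, *On the scaling limits of planar percolation*, Ann. Probab. 39 (2011)
  1768–1814, arXiv:1101.5820, §4, proof of Prop. 4.1 ("Bays and beaches"). [SchrammSmirnov2011]
* R. Diestel, *Graph Theory*, 5th ed., Springer GTM 173 (2017), Prop. 1.9.1/Thm. 1.8.1 (even
  degrees and cycles; handshake). [Diestel2017]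

Tree: `ClosedWalk`, `ClosedWalk.W`, `W_succ_fst`, `W_succ_snd`, `cV_eq_cnt`, `cH_eq_cnt`,
`cV_eq_zero_of_lower/upper`, `cH_eq_zero_of_left/right` (`LatticeLoopWinding.lean`); `toZ2`,
`toZ2_add_cornerUnit_*`, `toZ2_faceAt_*`, `add_cornerUnit_add_cornerUnit_add_two` (`DiscreteFaceBoundary.lean`);
`CellComplex.dartEdge`, `exists_dartEdge_eq` (`TileDomain.lean`).
-/

noncomputable section

open Finset Relation
open Literature.Probability.LatticeModels

namespace Literature.Probability.Percolation

/-! ### Even edge sets: the parity lemma -/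

section Parity

open scoped Classical

variable {V : Type*}

/-- The degree of a vertex in a finite edge set. [folklore] -/
def edeg (E : Finset (Sym2 V)) (v : V) : ℕ := (E.filter fun e => v ∈ e).card

/-- Adjacency through an edge of the edge set. [folklore] -/
def EAdj (E : Finset (Sym2 V)) (x y : V) : Prop := s(x, y) ∈ E

/-- `EAdj` is symmetric. [folklore] -/
theorem EAdj.symm {E : Finset (Sym2 V)} {x y : V} (h : EAdj E x y) : EAdj E y x := by
  unfold EAdj at h ⊢; rwa [Sym2.eq_swap]

/-- Reachability through an edge set is symmetric. [folklore] -/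
theorem reflTransGen_eAdj_symm {E : Finset (Sym2 V)} {x y : V} (h : ReflTransGen (EAdj E) x y) :
    ReflTransGen (EAdj E) y x := by
  induction h with
  | refl => exact ReflTransGen.refl
  | tail _ hbc ih => exact ReflTransGen.head hbc.symm ih

/-- The number of vertices of `S` on a non-loop edge `{x, y}`. [folklore] -/
theorem card_filter_mem_sym2 (S : Finset V) {x y : V} (hxy : x ≠ y) :
    (S.filter fun v => v ∈ s(x, y)).card = (if x ∈ S then 1 else 0) + (if y ∈ S then 1 else 0) := by
  have : S.filter (fun v => v ∈ s(x, y)) = (S.filter fun v => v = x) ∪ (S.filter fun v => v = y) := by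
    ext v; simp only [mem_filter, Sym2.mem_iff, mem_union]; tauto
  have single : ∀ z : V, (S.filter fun v => v = z).card = if z ∈ S then 1 else 0 := by
    intro z
    by_cases hz : z ∈ S
    · rw [if_pos hz, Finset.card_eq_one]
      refine ⟨z, ?_⟩
      ext v
      simp only [mem_filter, mem_singleton]
      exact ⟨fun h => h.2, fun h => ⟨h ▸ hz, h⟩⟩
    · rw [if_neg hz, Finset.card_eq_zero, Finset.filter_eq_empty_iff]
      rintro v hv rfl
      exact hz hv
  rw [this, card_union_of_disjoint]
  · rw [single x, single y]
  · rw [Finset.disjoint_filter]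
    rintro v - rfl rfl
    exact hxy rfl

/-- **Handshake parity**: if every vertex of `Vs ⊇ ⋃ E` has even degree, then for every `S ⊆ Vs` the
total number of incidences `∑_{e ∈ E} #(S ∩ e)` is even. [cite: Diestel2017, Prop. 1.2.1 (handshake)] -/
theorem even_sum_card_filter (E : Finset (Sym2 V)) {Vs : Finset V} (hdeg : ∀ v ∈ Vs, Even (edeg E v))
    {S : Finset V} (hS : S ⊆ Vs) : Even (∑ e ∈ E, (S.filter fun v => v ∈ e).card) := by
  have h1 : ∑ e ∈ E, (S.filter fun v => v ∈ e).card = ∑ e ∈ E, ∑ v ∈ S, if v ∈ e then 1 else 0 := by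
    refine sum_congr rfl fun e _ => ?_
    rw [card_filter]
  have h2 : ∑ e ∈ E, ∑ v ∈ S, (if v ∈ e then 1 else 0) = ∑ v ∈ S, edeg E v := by
    rw [sum_comm]
    refine sum_congr rfl fun v _ => ?_
    rw [edeg, card_filter]
  rw [h1, h2]
  exact Finset.even_sum _ (fun v hv => hdeg v (hS hv))

/-- The component of `a` in an edge set `E'` meets every non-loop edge of `E'` in `0` or `2`
vertices. [folklore] -/
theorem even_card_filter_of_closed {E' : Finset (Sym2 V)} {Vs : Finset V} (hVs : ∀ e ∈ E', ∀ v ∈ e, v ∈ Vs)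
    (a : V) {e : Sym2 V} (he : e ∈ E') (hnd : ¬ e.IsDiag) :
    Even (((Vs.filter fun v => ReflTransGen (EAdj E') a v).filter fun v => v ∈ e).card) := by
  set S := Vs.filter fun v => ReflTransGen (EAdj E') a v with hSdef
  induction e using Sym2.ind with
  | _ x y =>
    have hxy : x ≠ y := fun h => hnd (by subst h; exact Sym2.mk_isDiag_iff.2 rfl)
    rw [card_filter_mem_sym2 S hxy]
    have hxS : x ∈ S ↔ ReflTransGen (EAdj E') a x := by
      simp only [hSdef, mem_filter, and_iff_right_iff_imp]
      exact fun _ => hVs _ he x (Sym2.mem_mk_left x y)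
    have hyS : y ∈ S ↔ ReflTransGen (EAdj E') a y := by
      simp only [hSdef, mem_filter, and_iff_right_iff_imp]
      exact fun _ => hVs _ he y (Sym2.mem_mk_right x y)
    by_cases hx : x ∈ S
    · have hy : y ∈ S := hyS.2 ((hxS.1 hx).tail he)
      rw [if_pos hx, if_pos hy]; exact ⟨1, rfl⟩
    · have hy : y ∉ S := fun hy => hx (hxS.2 ((hyS.1 hy).tail (EAdj.symm he)))
      rw [if_neg hx, if_neg hy]; exact ⟨0, rfl⟩

/-- **Parity lemma (an even graph has no bridge).**  In a finite set of non-loop edges all of whose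
vertex degrees are even, the two ends of an edge are still joined after the edge is deleted.
[cite: Diestel2017, Prop. 1.9.1 / Thm. 1.8.1 (Euler: even degrees ⇒ every edge lies on a cycle)] -/
theorem reflTransGen_erase_of_even (E : Finset (Sym2 V)) (hnd : ∀ e ∈ E, ¬ e.IsDiag) {Vs : Finset V}
    (hVs : ∀ e ∈ E, ∀ v ∈ e, v ∈ Vs) (hdeg : ∀ v ∈ Vs, Even (edeg E v)) {a b : V} (hab : s(a, b) ∈ E) :
    ReflTransGen (EAdj (E.erase s(a, b))) a b := by
  classical
  set E' := E.erase s(a, b) with hE'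
  set S := Vs.filter fun v => ReflTransGen (EAdj E') a v with hSdef
  by_contra hcon
  have haS : a ∈ S := mem_filter.2 ⟨hVs _ hab a (Sym2.mem_mk_left a b), ReflTransGen.refl⟩
  have hbS : b ∉ S := fun h => hcon (mem_filter.1 h).2
  have hab' : a ≠ b := fun h => by
    have := hnd _ hab; rw [h] at this; exact this (Sym2.mk_isDiag_iff.2 rfl)
  -- the incidence sum over `E` is even …
  have heven := even_sum_card_filter E hdeg (S := S) (filter_subset _ _)
  -- … but it is the even sum over `E'` plus `1`
  rw [← Finset.insert_erase hab, sum_insert (Finset.notMem_erase _ _)] at heven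
  have h1 : (S.filter fun v => v ∈ s(a, b)).card = 1 := by
    rw [card_filter_mem_sym2 S hab', if_pos haS, if_neg hbS]
  rw [h1] at heven
  have hrest : Even (∑ e ∈ E', (S.filter fun v => v ∈ e).card) :=
    Finset.even_sum _ (fun e he => even_card_filter_of_closed (fun e he v hv => hVs e (mem_of_mem_erase he) v hv) a he
      (hnd e (mem_of_mem_erase he)))
  rw [← hE'] at heven
  have h2 := Nat.even_iff.1 heven
  have h3 := Nat.even_iff.1 hrest
  omega

/-- **Parity lemma, two edges.**  In a finite set of non-loop edges with all vertex degrees even,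
the outer ends `c`, `c'` of a path of two distinct edges `{c, m}`, `{m, c'}` (`c ≠ c'`) are still
joined after both edges are deleted. [cite: Diestel2017, Prop. 1.9.1 / Thm. 1.8.1] -/
theorem reflTransGen_erase_erase_of_even (E : Finset (Sym2 V)) (hnd : ∀ e ∈ E, ¬ e.IsDiag) {Vs : Finset V}
    (hVs : ∀ e ∈ E, ∀ v ∈ e, v ∈ Vs) (hdeg : ∀ v ∈ Vs, Even (edeg E v)) {c m c' : V} (hcc' : c ≠ c')
    (h₁ : s(c, m) ∈ E) (h₂ : s(m, c') ∈ E) :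
    ReflTransGen (EAdj ((E.erase s(c, m)).erase s(m, c'))) c c' := by
  classical
  set E' := (E.erase s(c, m)).erase s(m, c') with hE'
  set S := Vs.filter fun v => ReflTransGen (EAdj E') c v with hSdef
  by_contra hcon
  have hcS : c ∈ S := mem_filter.2 ⟨hVs _ h₁ c (Sym2.mem_mk_left c m), ReflTransGen.refl⟩
  have hc'S : c' ∉ S := fun h => hcon (mem_filter.1 h).2
  have hcm : c ≠ m := fun h => by
    have := hnd _ h₁; rw [h] at this; exact this (Sym2.mk_isDiag_iff.2 rfl)
  have hmc' : m ≠ c' := fun h => by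
    have := hnd _ h₂; rw [h] at this; exact this (Sym2.mk_isDiag_iff.2 rfl)
  have hne : s(c, m) ≠ s(m, c') := by
    intro h
    rcases Sym2.eq_iff.1 h with ⟨h1, -⟩ | ⟨h1, h2⟩
    · exact hcm h1
    · exact hcc' h1
  have h₂' : s(m, c') ∈ E.erase s(c, m) := mem_erase.2 ⟨hne.symm, h₂⟩
  have heven := even_sum_card_filter E hdeg (S := S) (filter_subset _ _)
  rw [← Finset.insert_erase h₁, sum_insert (Finset.notMem_erase _ _),
    ← Finset.insert_erase h₂', sum_insert (Finset.notMem_erase _ _)] at heven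
  have hrest : Even (∑ e ∈ E', (S.filter fun v => v ∈ e).card) :=
    Finset.even_sum _ (fun e he => even_card_filter_of_closed
      (fun e he v hv => hVs e (mem_of_mem_erase (mem_of_mem_erase he)) v hv) c he
      (hnd e (mem_of_mem_erase (mem_of_mem_erase he))))
  rw [card_filter_mem_sym2 S hcm, card_filter_mem_sym2 S hmc', if_pos hcS, if_neg hc'S, ← hE'] at heven
  have h3 := Nat.even_iff.1 hrest
  by_cases hmS : m ∈ S
  · rw [if_pos hmS] at heven
    have h2 := Nat.even_iff.1 heven
    omega
  · rw [if_neg hmS] at heven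
    have h2 := Nat.even_iff.1 heven
    omega

/-- **Propagation along a path of good edges.**  If every edge of `E` is "strong" (both ends in `P`)
or "weak" (no end in `P`), then a vertex reachable through `E` from a vertex of `P` is in `P` and
is reached through strong edges only. [folklore] -/
theorem reflTransGen_strong_of_dichotomy {E : Finset (Sym2 V)} {P : V → Prop}
    (hE : ∀ x y, s(x, y) ∈ E → (P x ∧ P y) ∨ (¬ P x ∧ ¬ P y)) {a b : V} (ha : P a)
    (h : ReflTransGen (EAdj E) a b) : P b ∧ ReflTransGen (fun x y => s(x, y) ∈ E ∧ P x ∧ P y) a b := by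
  induction h with
  | refl => exact ⟨ha, ReflTransGen.refl⟩
  | @tail x y _ hxy ih =>
    obtain ⟨hx, hreach⟩ := ih
    rcases hE x y hxy with ⟨-, hy⟩ | ⟨hx', -⟩
    · exact ⟨hy, hreach.tail ⟨hxy, hx, hy⟩⟩
    · exact absurd hx hx'

end Parity

/-! ### Closed lattice walks from periodic sequences of sites; winding numbers in `ℤ²` language -/

section Winding

open DiscreteDobrushin

/-- A step along a corner unit is `RectLoop`-adjacency in coordinates. [folklore] -/
theorem rectLoopAdj_toZ2_add_cornerUnit (x : Site 2) (k : Fin 4) :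
    Literature.Topology.PlaneTopology.RectLoop.Adj (toZ2 x) (toZ2 (x + cornerUnit k)) := by
  rw [LatticeModels.adj_iff]
  match k with
  | 0 => left; rw [toZ2_add_cornerUnit_zero]; exact ⟨rfl, rfl⟩
  | 1 => right; left; rw [toZ2_add_cornerUnit_one]; exact ⟨rfl, rfl⟩
  | 2 => right; right; left; rw [toZ2_add_cornerUnit_two]; exact ⟨rfl, rfl⟩
  | 3 => right; right; right; rw [toZ2_add_cornerUnit_three]; exact ⟨rfl, rfl⟩

/-- Lattice neighbours of `ℤ²` are `RectLoop`-adjacent in coordinates. [folklore] -/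
theorem rectLoopAdj_toZ2 {x y : Site 2} (h : (zdGraph 2).Adj x y) :
    Literature.Topology.PlaneTopology.RectLoop.Adj (toZ2 x) (toZ2 y) := by
  obtain ⟨w, k, he⟩ := CellComplex.exists_dartEdge_eq ((zdGraph 2).mem_edgeSet.2 h)
  rw [CellComplex.dartEdge, Sym2.eq_iff] at he
  rcases he with ⟨h1, h2⟩ | ⟨h1, h2⟩
  · rw [h1, h2]; exact rectLoopAdj_toZ2_add_cornerUnit w k
  · rw [h1, h2]
    have : w = w + cornerUnit k + cornerUnit (k + 2) := (add_cornerUnit_add_cornerUnit_add_two w k).symm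
    conv_rhs => rw [this]
    exact rectLoopAdj_toZ2_add_cornerUnit _ _

/-- **The closed walk of a periodic sequence of lattice neighbours.** [folklore] -/
def _root_.Literature.Probability.LatticeModels.ClosedWalk.ofSites {n : ℕ} (w : ℕ → Site 2) (hper : ∀ j, w (j + n) = w j)
    (hadj : ∀ j, (zdGraph 2).Adj (w j) (w (j + 1))) : ClosedWalk n where
  v j := toZ2 (w j)
  periodic j := by simp only [hper]
  adj j := rectLoopAdj_toZ2 (hadj j)

variable {n : ℕ} (c : ClosedWalk n)

/-- The traversal count of a directed step that never occurs vanishes. [folklore] -/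
theorem _root_.Literature.Probability.LatticeModels.ClosedWalk.cnt_eq_zero_of_forall {P Q : ℤ × ℤ} (h : ∀ j, ¬ (c.v j = P ∧ c.v (j + 1) = Q)) :
    c.cnt P Q = 0 :=
  Finset.sum_eq_zero fun j _ => indZ_of_neg (h j)

/-- **The four faces at a lattice point off the walk have the same winding number.** [folklore] -/
theorem _root_.Literature.Probability.LatticeModels.ClosedWalk.W_faceAt_eq_of_notMem {x : Site 2} (hx : ∀ j, c.v j ≠ toZ2 x) (k : Fin 4) :
    c.W (toZ2 (faceAt x k)) = c.W (toZ2 (faceAt x 0)) := by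
  have h0 := toZ2_faceAt_zero x
  have hx' : ∀ j, c.v j ≠ (x 0, x 1) := fun j h => hx j (by rw [h]; rfl)
  have h1 : c.W (x 0 - 1, x 1) = c.W (x 0, x 1) := by
    have := c.W_succ_fst (x 0 - 1) (x 1)
    rw [sub_add_cancel, c.cV_eq_zero_of_lower hx', sub_zero] at this
    exact this.symm
  have h2 : c.W (x 0, x 1 - 1) = c.W (x 0, x 1) := by
    have := c.W_succ_snd (x 0) (x 1 - 1)
    rw [sub_add_cancel, c.cH_eq_zero_of_left hx', add_zero] at this
    exact this.symm
  have h3 : c.W (x 0 - 1, x 1 - 1) = c.W (x 0, x 1 - 1) := by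
    have := c.W_succ_fst (x 0 - 1) (x 1 - 1)
    rw [sub_add_cancel, c.cV_eq_zero_of_upper (by rw [sub_add_cancel]; exact hx'), sub_zero] at this
    exact this.symm
  rw [h0]
  match k with
  | 0 => rw [toZ2_faceAt_zero]
  | 1 => rw [toZ2_faceAt_one, h1]
  | 2 => rw [toZ2_faceAt_two, h3, h2]
  | 3 => rw [toZ2_faceAt_three, h2]

/-- **Jump across the edge of a dart**: the winding number of the left face `faceAt x k` minus that
of the right face `faceAt x (k + 3)` of the dart `(x, k)` is the net number of traversals of the
dart (forward minus backward). [folklore] -/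
theorem _root_.Literature.Probability.LatticeModels.ClosedWalk.W_left_sub_W_right (x : Site 2) (k : Fin 4) :
    c.W (toZ2 (faceAt x k)) - c.W (toZ2 (faceAt x (k + 3))) =
      c.cnt (toZ2 x) (toZ2 (x + cornerUnit k)) - c.cnt (toZ2 (x + cornerUnit k)) (toZ2 x) := by
  have hx : toZ2 x = (x 0, x 1) := rfl
  match k with
  | 0 =>
    -- east: left face `(x₀, x₁)`, right face `(x₀, x₁ - 1)`; horizontal edge at height `x₁`
    rw [show (0 : Fin 4) + 3 = 3 from rfl, toZ2_faceAt_zero, toZ2_faceAt_three, toZ2_add_cornerUnit_zero, hx]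
    have := c.W_succ_snd (x 0) (x 1 - 1)
    rw [sub_add_cancel, c.cH_eq_cnt] at this
    linarith
  | 1 =>
    -- north: left face `(x₀ - 1, x₁)`, right face `(x₀, x₁)`; vertical edge at abscissa `x₀`
    rw [show (1 : Fin 4) + 3 = 0 from rfl, toZ2_faceAt_one, toZ2_faceAt_zero, toZ2_add_cornerUnit_one, hx]
    have := c.W_succ_fst (x 0 - 1) (x 1)
    rw [sub_add_cancel, c.cV_eq_cnt] at this
    linarith
  | 2 =>
    -- west: left face `(x₀ - 1, x₁ - 1)`, right face `(x₀ - 1, x₁)`; horizontal edge at height `x₁`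
    rw [show (2 : Fin 4) + 3 = 1 from rfl, toZ2_faceAt_two, toZ2_faceAt_one, toZ2_add_cornerUnit_two, hx]
    have := c.W_succ_snd (x 0 - 1) (x 1 - 1)
    rw [sub_add_cancel, c.cH_eq_cnt, sub_add_cancel] at this
    linarith
  | 3 =>
    -- south: left face `(x₀, x₁ - 1)`, right face `(x₀ - 1, x₁ - 1)`; vertical edge at abscissa `x₀`
    rw [show (3 : Fin 4) + 3 = 2 from rfl, toZ2_faceAt_three, toZ2_faceAt_two, toZ2_add_cornerUnit_three, hx]
    have := c.W_succ_fst (x 0 - 1) (x 1 - 1)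
    rw [sub_add_cancel, c.cV_eq_cnt, sub_add_cancel] at this
    linarith

/-- **No jump across an edge not traversed** (in either direction). [folklore] -/
theorem _root_.Literature.Probability.LatticeModels.ClosedWalk.W_eq_of_cnt_eq_zero {x : Site 2} {k : Fin 4}
    (h₁ : c.cnt (toZ2 x) (toZ2 (x + cornerUnit k)) = 0) (h₂ : c.cnt (toZ2 (x + cornerUnit k)) (toZ2 x) = 0) :
    c.W (toZ2 (faceAt x k)) = c.W (toZ2 (faceAt x (k + 3))) := by
  have := c.W_left_sub_W_right x k
  rw [h₁, h₂, sub_zero] at this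
  exact sub_eq_zero.1 this

/-- For the closed walk of a sequence of sites: the traversal count of a step `x → y` vanishes if the
sequence never steps from `x` to `y`. [folklore] -/
theorem _root_.Literature.Probability.LatticeModels.ClosedWalk.cnt_ofSites_eq_zero {w : ℕ → Site 2} {hper : ∀ j, w (j + n) = w j}
    {hadj : ∀ j, (zdGraph 2).Adj (w j) (w (j + 1))} {x y : Site 2} (h : ∀ j, ¬ (w j = x ∧ w (j + 1) = y)) :
    (ClosedWalk.ofSites w hper hadj).cnt (toZ2 x) (toZ2 y) = 0 := by
  exact ClosedWalk.cnt_eq_zero_of_forall _ fun j ⟨hj, hj'⟩ => h j ⟨toZ2_injective hj, toZ2_injective hj'⟩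

/-- For the closed walk of a sequence of sites: a site not on the sequence is off the walk. [folklore] -/
theorem _root_.Literature.Probability.LatticeModels.ClosedWalk.v_ofSites_ne {w : ℕ → Site 2} {hper : ∀ j, w (j + n) = w j}
    {hadj : ∀ j, (zdGraph 2).Adj (w j) (w (j + 1))} {x : Site 2} (h : ∀ j, w j ≠ x) (j : ℕ) :
    (ClosedWalk.ofSites w hper hadj).v j ≠ toZ2 x := fun hj => h j (toZ2_injective hj)

end Winding

end Literature.Probability.Percolation

end
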